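import Summits.AtomisticToContinuum.FouriersLaw.Theorems.HonestZwanzigNetworkReductionPackage
import Summits.AtomisticToContinuum.FouriersLaw.Theorems.HonestZwanzigGeneratorSiteEnergy

/-!
# HonestZwanzig / OrthogonalOhm — the row identity (homogeneity identity and contact sum rules)

Support file for crux `stmt-AtomisticToContinuum-12693` (`OrthogonalOhm` of route `HonestZwanzig`,
sub-problem `FouriersLaw`), line `Sketch`, stub `stub_rowIdentity` (S2). For the canonical objects of
the route at fixed `N ≥ 2` and EVERY Laplace variable `s > 0` (`σ_b(s) = schur_s(j_b, J)`,
`τ_y(s) = schur_s(p_y², J)`, `χ = Cov(e,e)`, `Ψ_u(s) = lap_s(e_u, J)`):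

  `Σ_b ([b = y] − [y = b+1]) σ_b(s) − γ([y = 0] + [y = N−1]) τ_y(s) = Σ_x Σ_u χ_{yx} (G(s)⁻¹)_{xu} Ψ_u(s)`,

i.e. `σ_y − σ_{y−1} = (χG⁻¹Ψ)_y` in the bulk and the two contact sum rules at `y = 0, N−1`.

Proof: the left side is `schur_s((L e_y)∘Θ, J)` by first-slot linearity of `f ↦ schur_s(f, J)`
(`schur_lincomb`) along the bond decomposition of `(L e_y)∘Θ` (`pkg_Lr_lap`, from
`GeneratorSiteEnergy`); expanding the Schur complement with the Kolmogorov identities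
`lap_s((L e_y)∘Θ, J) = −s·lap_s(J, e_y)` (`pkg_K4`), `lap_s((L e_y)∘Θ, e_x) = s·G_{yx} − χ_{yx}`
(`pkg_K1`), time reversal `lap_s(e_u, J) = −lap_s(J, e_u)` (`pkg_rev`) and `G(s)G(s)⁻¹ = 1` (`G(s)`
is symmetric by `pkg_G_symm` and positive by `FeshbachIdentities`), the two `s`-terms cancel and
`−(χ G⁻¹ a)_y` with `a_u = lap_s(J, e_u) = −Ψ_u(s)` remains.
-/

noncomputable section

open MeasureTheory Finset Real Set
open Literature.MathematicalPhysics.KineticTheory.HeatConduction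

namespace Summit.AtomisticToContinuum.FouriersLaw.Theorems.HonestZwanzig

namespace OrthogonalOhmLine.stub_rowIdentity

open Matrix NetworkReduction

/-! ### The abstract row identity (pure circuit algebra at one fixed `s`) -/

section Circuit

variable {X : Type*} {N : ℕ}

/-- **Abstract row identity.** For abstract pairings `lap, cov, schur` at one fixed `s`, with
`G = [lap(e_x, e_y)]` symmetric with positive quadratic form, `schur` the Schur complement of the
site energies, time reversal on the current, the first Kolmogorov identities of `Lr y = (L e_y)∘Θ`
against `e_u` and `J`, and the bond decomposition of `lap(Lr y, ·)` against `J` and every `e_u`: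
`Σ_b ([b = y] − [y = b+1]) schur(j_b, J) − γ[y ∈ ∂] schur(p_y², J) = Σ_x Σ_u cov(e_y,e_x) G⁻¹_{xu} lap(e_u, J)`. -/
theorem circuit_rowIdentity (lap cov schur : (X → ℝ) → (X → ℝ) → ℝ) (e j psq Lr : Fin N → X → ℝ)
    (J : X → ℝ) (G : Matrix (Fin N) (Fin N) ℝ) (s γ : ℝ)
    (hG : ∀ x y, G x y = lap (e x) (e y))
    (hschur : ∀ f g, schur f g = lap f g - ∑ x, ∑ y, lap f (e x) * G⁻¹ x y * lap (e y) g)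
    (hGs : ∀ x y, lap (e x) (e y) = lap (e y) (e x))
    (hGp : ∀ v : Fin N → ℝ, v ≠ 0 → 0 < ∑ x, ∑ y, v x * G x y * v y)
    (hrev : ∀ x, lap (e x) J = -lap J (e x))
    (hK1 : ∀ x u, lap (Lr x) (e u) = s * lap (e x) (e u) - cov (e x) (e u))
    (hK4 : ∀ y, lap (Lr y) J = -(s * lap J (e y)))
    (hLrJ : ∀ y, lap (Lr y) J =
      (∑ b, ((if b = y then 1 else 0) - (if y.val = b.val + 1 then 1 else 0)) * lap (j b) J) +
        (-(γ * ((if y.val = 0 then 1 else 0) + (if y.val = N - 1 then 1 else 0)))) * lap (psq y) J)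
    (hLre : ∀ y u, lap (Lr y) (e u) =
      (∑ b, ((if b = y then 1 else 0) - (if y.val = b.val + 1 then 1 else 0)) * lap (j b) (e u)) +
        (-(γ * ((if y.val = 0 then 1 else 0) + (if y.val = N - 1 then 1 else 0)))) * lap (psq y) (e u))
    (y : Fin N) :
    (∑ b, ((if b = y then (1 : ℝ) else 0) - (if y.val = b.val + 1 then 1 else 0)) * schur (j b) J) +
        (-(γ * ((if y.val = 0 then (1 : ℝ) else 0) + (if y.val = N - 1 then 1 else 0)))) *
          schur (psq y) J =
      ∑ x, ∑ u, cov (e y) (e x) * G⁻¹ x u * lap (e u) J := by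
  -- `G` is invertible
  have hGsym : ∀ x y, G x y = G y x := fun x y => by rw [hG, hG, hGs]
  have hGpd : G.PosDef := posDef_of_symm_of_pos G hGsym hGp
  have hGG : G * G⁻¹ = 1 :=
    Matrix.mul_nonsing_inv G ((Matrix.isUnit_iff_isUnit_det G).1 hGpd.isUnit)
  -- the vector `a_x = lap(J, e_x)` and `(G G⁻¹ a)_y = a_y`
  set a : Fin N → ℝ := fun x => lap J (e x) with ha
  have hGa : ∑ u, ∑ v, G y u * G⁻¹ u v * a v = a y := by
    have h := congrFun (congrArg (fun M : Matrix (Fin N) (Fin N) ℝ => M *ᵥ a) hGG) y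
    simp only [Matrix.one_mulVec] at h
    rw [← h, ← Matrix.mulVec_mulVec]
    simp only [Matrix.mulVec, dotProduct, Finset.mul_sum, mul_assoc]
  -- `schur(Lr y, J) = −(C G⁻¹ a)_y`: the `s`-terms cancel
  have h1 : schur (Lr y) J = -(∑ u, ∑ v, cov (e y) (e u) * G⁻¹ u v * a v) := by
    rw [hschur, hK4]
    have : ∀ u v, lap (Lr y) (e u) * G⁻¹ u v * lap (e v) J =
        -(s * (G y u * G⁻¹ u v * a v)) + cov (e y) (e u) * G⁻¹ u v * a v := by
      intro u v
      rw [hK1, hrev, ← hG, ha]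
      ring
    simp_rw [this]
    simp only [Finset.sum_add_distrib, Finset.sum_neg_distrib, ← Finset.mul_sum]
    rw [hGa, ha]
    ring
  -- the right-hand side is `−(C G⁻¹ a)_y` by time reversal
  have h2 : ∑ x, ∑ u, cov (e y) (e x) * G⁻¹ x u * lap (e u) J =
      -(∑ u, ∑ v, cov (e y) (e u) * G⁻¹ u v * a v) := by
    rw [← Finset.sum_neg_distrib]
    refine Finset.sum_congr rfl fun u _ => ?_
    rw [← Finset.sum_neg_distrib]
    refine Finset.sum_congr rfl fun v _ => ?_
    rw [hrev, ha]
    ring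
  -- the left-hand side is `schur(Lr y, J)` by linearity along the bond decomposition
  rw [← schur_lincomb lap schur e J G hschur _ _ (Lr y) (psq y) j (hLrJ y) (hLre y), h1, h2]

end Circuit

/-! ### The row identity for the canonical objects of the route -/

section Package

variable {ω₂ lam β γ : ℝ} {N : ℕ} {T : ℝ}
  {Adm : (PhaseSpace N → ℝ) → Prop}
  {corr : (PhaseSpace N → ℝ) → (PhaseSpace N → ℝ) → ℝ → ℝ}
  {lap : ℝ → (PhaseSpace N → ℝ) → (PhaseSpace N → ℝ) → ℝ}
  {cov : (PhaseSpace N → ℝ) → (PhaseSpace N → ℝ) → ℝ}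
  {e : Fin N → PhaseSpace N → ℝ}
  (hAdm : ∀ f, Adm f ↔ (Continuous f ∧ ∃ A : ℝ, ∀ z,
    |f z| ≤ A * Real.exp ((pinnedChain ω₂ lam β γ).hamiltonian N z / (8 * T))))
  (hcorr : ∀ f g t, corr f g t =
    (∫ z, f z * (∫ y, g y ∂((pinnedChain ω₂ lam β γ).transitionKernel N T T t.toNNReal z))
      ∂(pinnedChain ω₂ lam β γ).gibbsMeasure N T) -
    (∫ z, f z ∂(pinnedChain ω₂ lam β γ).gibbsMeasure N T) *
      (∫ z, g z ∂(pinnedChain ω₂ lam β γ).gibbsMeasure N T))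
  (hlap : ∀ s f g, lap s f g = ∫ t in Set.Ioi (0 : ℝ), Real.exp (-(s * t)) * corr f g t)
  (hcov : ∀ f g, cov f g = (∫ z, f z * g z ∂(pinnedChain ω₂ lam β γ).gibbsMeasure N T) -
    (∫ z, f z ∂(pinnedChain ω₂ lam β γ).gibbsMeasure N T) *
      (∫ z, g z ∂(pinnedChain ω₂ lam β γ).gibbsMeasure N T))
  (he : ∀ x z, e x z = z.2 x ^ 2 / 2 + (pinnedChain ω₂ lam β γ).U (z.1 x) +
    ∑ j : Fin N, ((if j.val = x.val + 1 then (pinnedChain ω₂ lam β γ).V (z.1 j - z.1 x) / 2 else 0) +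
      (if x.val = j.val + 1 then (pinnedChain ω₂ lam β γ).V (z.1 x - z.1 j) / 2 else 0)))
  (hFI : ∀ f g : PhaseSpace N → ℝ, Adm f → Adm g →
    Integrable f ((pinnedChain ω₂ lam β γ).gibbsMeasure N T) ∧
    (∀ t : ℝ, 0 ≤ t → Integrable (fun z => f z *
      (∫ y, g y ∂((pinnedChain ω₂ lam β γ).transitionKernel N T T t.toNNReal z)))
      ((pinnedChain ω₂ lam β γ).gibbsMeasure N T)) ∧
    IntegrableOn (corr f g) (Set.Ioi 0) ∧
    (∀ t : ℝ, 0 ≤ t → corr f g t = corr (fun z => g (z.1, -z.2)) (fun z => f (z.1, -z.2)) t) ∧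
    (∀ s : ℝ, 0 < s → ∀ x : Fin N,
      s * lap s (e x) g - cov (e x) g =
        lap s (fun z => (pinnedChain ω₂ lam β γ).generator N T T (e x) (z.1, -z.2)) g ∧
      s * lap s f (e x) - cov f (e x) = lap s f ((pinnedChain ω₂ lam β γ).generator N T T (e x))))
  (hGSE : ∀ (x : Fin N) (z : PhaseSpace N), (pinnedChain ω₂ lam β γ).generator N T T (e x) z =
    (∑ b : Fin N, ((if x.val = b.val + 1 then (pinnedChain ω₂ lam β γ).bondCurrent N b z else 0) -
      (if b = x then (pinnedChain ω₂ lam β γ).bondCurrent N b z else 0))) +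
    (if x.val = 0 then (pinnedChain ω₂ lam β γ).γ * (T - z.2 x ^ 2) else 0) +
    (if x.val = N - 1 then (pinnedChain ω₂ lam β γ).γ * (T - z.2 x ^ 2) else 0))
  (hω : 0 < ω₂) (hl : 0 ≤ lam) (hβ : 0 ≤ β) (hγ : 0 ≤ γ) (hT : 0 < T)

include hAdm hcorr hlap hcov hFI he hGSE hω hl hβ hγ hT in
/-- **The row identity for the canonical objects** at fixed `N` and fixed `s > 0`, for `G(s)` with
positive quadratic form: `Σ_b ([b = y] − [y = b+1]) schur_s(j_b, J) − γ([y = 0] + [y = N−1])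
schur_s(p_y², J) = Σ_x Σ_u cov(e_y, e_x) (G(s)⁻¹)_{xu} lap_s(e_u, J)`. -/
theorem pkg_rowIdentity {s : ℝ} (hs : 0 < s)
    (G : Matrix (Fin N) (Fin N) ℝ) (hG : ∀ x y, G x y = lap s (e x) (e y))
    (schur : (PhaseSpace N → ℝ) → (PhaseSpace N → ℝ) → ℝ)
    (hschur : ∀ f g, schur f g = lap s f g - ∑ x, ∑ y, lap s f (e x) * G⁻¹ x y * lap s (e y) g)
    (hGp : ∀ v : Fin N → ℝ, v ≠ 0 → 0 < ∑ x, ∑ y, v x * G x y * v y) (y : Fin N) :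
    (∑ b : Fin N, ((if b = y then (1 : ℝ) else 0) - (if y.val = b.val + 1 then 1 else 0)) *
        schur ((pinnedChain ω₂ lam β γ).bondCurrent N b)
          (fun z => ∑ i : Fin N, (pinnedChain ω₂ lam β γ).bondCurrent N i z)) +
      (-((pinnedChain ω₂ lam β γ).γ * ((if y.val = 0 then (1 : ℝ) else 0) +
        (if y.val = N - 1 then 1 else 0)))) * schur (fun z => z.2 y ^ 2)
          (fun z => ∑ i : Fin N, (pinnedChain ω₂ lam β γ).bondCurrent N i z) =
      ∑ x, ∑ u, cov (e y) (e x) * G⁻¹ x u *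
        lap s (e u) (fun z => ∑ i : Fin N, (pinnedChain ω₂ lam β γ).bondCurrent N i z) := by
  have hJ : Adm (fun z => ∑ i : Fin N, (pinnedChain ω₂ lam β γ).bondCurrent N i z) :=
    adm_totalCurrent Adm hAdm hω hl hβ hT
  have hex : ∀ x, Adm (e x) := fun x => adm_e Adm hAdm e he hω hl hβ hT x
  exact circuit_rowIdentity (lap s) cov schur e ((pinnedChain ω₂ lam β γ).bondCurrent N)
    (fun y z => z.2 y ^ 2) (fun y z => (pinnedChain ω₂ lam β γ).generator N T T (e y) (z.1, -z.2))
    (fun z => ∑ i : Fin N, (pinnedChain ω₂ lam β γ).bondCurrent N i z) G s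
    (pinnedChain ω₂ lam β γ).γ hG hschur (pkg_G_symm hAdm hlap he hFI hω hl hβ hT s) hGp
    (pkg_rev hAdm hcorr hlap he hFI hω hl hβ hT s) (pkg_K1 hAdm he hFI hω hl hβ hT hs)
    (pkg_K4 hAdm hcorr hlap hcov he hFI hGSE hω hl hβ hT hs)
    (fun y => pkg_Lr_lap hAdm hcorr hlap hFI hGSE hω hl hβ hγ hT hs.le y hJ)
    (fun y u => pkg_Lr_lap hAdm hcorr hlap hFI hGSE hω hl hβ hγ hT hs.le y (hex u)) y

end Package

end OrthogonalOhmLine.stub_rowIdentity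

/-! ### The registered stub -/

/-- **Stub S2** (homogeneity identity and contact sum rules at finite `s`, W4/W5 of the zero-frequency Ward
dictionary; support identity of line `Sketch` of crux `OrthogonalOhm`): for every site `y`,
`Σ_b ([b = y] − [y = b+1]) schur_s(j_b, J) − γ([y = 0] + [y = N−1]) schur_s(p_y², J) = (χ G(s)⁻¹ Ψ(s))_y` with
`Ψ_u(s) = lap_s(e_u, J)` — i.e. `ρ_y(s) − ρ_{y−1}(s) = (χG⁻¹Ψ)_y` in the bulk and `ρ_0(s) − γτ_0(s) = (χG⁻¹Ψ)_0`,
`−ρ_{N−2}(s) − γτ_{N−1}(s) = (χG⁻¹Ψ)_{N−1}` at the contacts, EXACTLY at every `s > 0`; from the Feshbach package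
(`pkg_K1`, `pkg_K4`, `pkg_Lr_lap`, `schur_lincomb`, `G(s)` invertible) and `GeneratorSiteEnergy`. -/
theorem stub_rowIdentity : Summit.AtomisticToContinuum.FouriersLaw.Theses.HonestZwanzig.FeshbachIdentities →
    ∀ ω₂ lam β γ : ℝ, 0 < ω₂ → 0 < lam → 0 < β → 0 < γ → ∀ T : ℝ, 0 < T → ∀ N : ℕ, 2 ≤ N → let P := Literature.MathematicalPhysics.KineticTheory.HeatConduction.pinnedChain ω₂ lam β γ; let X := Literature.MathematicalPhysics.KineticTheory.HeatConduction.PhaseSpace N; let μ : MeasureTheory.Measure X := P.gibbsMeasure N T; let corr : (X → ℝ) → (X → ℝ) → ℝ → ℝ := fun f g t => (∫ z, f z * (∫ y, g y ∂(P.transitionKernel N T T t.toNNReal z)) ∂μ) - (∫ z, f z ∂μ) * (∫ z, g z ∂μ); let lap : ℝ → (X → ℝ) → (X → ℝ) → ℝ := fun s f g => ∫ t in Set.Ioi (0 : ℝ), Real.exp (-(s * t)) * corr f g t; let cov : (X → ℝ) → (X → ℝ) → ℝ := fun f g => (∫ z, f z * g z ∂μ) - (∫ z, f z ∂μ) * (∫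 z, g z ∂μ); let e : Fin N → X → ℝ := fun x z => z.2 x ^ 2 / 2 + P.U (z.1 x) + ∑ j : Fin N, ((if j.val = x.val + 1 then P.V (z.1 j - z.1 x) / 2 else 0) + (if x.val = j.val + 1 then P.V (z.1 x - z.1 j) / 2 else 0)); let G : ℝ → Matrix (Fin N) (Fin N) ℝ := fun s => Matrix.of fun x y => lap s (e x) (e y); let schur : ℝ → (X → ℝ) → (X → ℝ) → ℝ := fun s f g => lap s f g - ∑ x : Fin N, ∑ y : Fin N, lap s f (e x) * (G s)⁻¹ x y * lap s (e y) g; let J : X → ℝ := fun z => ∑ i : Fin N, P.bondCurrent N i z; ∀ s : ℝ, 0 < s → ∀ y : Fin N,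
      (∑ b : Fin N, ((if b = y then (1 : ℝ) else 0) - (if y.val = b.val + 1 then 1 else 0)) * schur s (P.bondCurrent N b) J) +
        (-(P.γ * ((if y.val = 0 then (1 : ℝ) else 0) + (if y.val = N - 1 then 1 else 0)))) * schur s (fun z => z.2 y ^ 2) J =
        ∑ x : Fin N, ∑ u : Fin N, cov (e y) (e x) * (G s)⁻¹ x u * lap s (e u) J := by
  intro hFI ω₂ lam β γ hω hl hβ hγ T hT N hN P X μ corr lap cov e G schur J s hs y
  obtain ⟨-, hFI2, -, hGp⟩ := hFI ω₂ lam β γ hω hl hβ hγ T hT N hN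
  exact OrthogonalOhmLine.stub_rowIdentity.pkg_rowIdentity (fun f => Iff.rfl) (fun f g t => rfl)
    (fun s f g => rfl) (fun f g => rfl) (fun x z => rfl) hFI2
    (fun x z => generatorSiteEnergy_proof ω₂ lam β γ N hN T T x z) hω hl.le hβ.le hγ.le hT hs (G s)
    (fun x y => rfl) (schur s) (fun f g => rfl) (hGp s hs) y

end Summit.AtomisticToContinuum.FouriersLaw.Theorems.HonestZwanzig
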